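import Summits.CriticalPhenomena.PercolationContinuityZ3.Theorems.PercNearOneGluingNoHeavyQuantLSCoreLMGBreakpoints
import Summits.CriticalPhenomena.PercolationContinuityZ3.Theorems.PercNearOneGluingNoHeavyQuantLSCoreLMGBreakpointsB1
import Summits.CriticalPhenomena.PercolationContinuityZ3.Theorems.PercNearOneGluingNoHeavyQuantLSCoreLMGBreakpointsA
import Summits.CriticalPhenomena.PercolationContinuityZ3.Theorems.PercNearOneGluingNoHeavyQuantLSCoreLMGBreakpointsC
import Summits.CriticalPhenomena.PercolationContinuityZ3.Theorems.PercNearOneGluingNoHeavyQuantLSCoreMMGEff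
import Summits.CriticalPhenomena.PercolationContinuityZ3.Theorems.PercNearOneGluingNoHeavyQuantLSCoreFlowB
import Summits.CriticalPhenomena.PercolationContinuityZ3.Theorems.PercNearOneGluingNoHeavyQuantTwoLowGreedy
import HarnessLib
/-!
# QUANT lane R8, T-DEC, binder (II) `ConvClosedTResidue`: LS-CORE, pattern LMG — DEC of the six-cell light-slice law when the row-`m` cell `m+l` is a third low (`2(m+l) < T ≤ 2(m+l′)`), span ratio `ω ≤ 1`
builds on p205010 (kernel theorem, internal audit signed; external expert review pending)
Support file (`--supports stmt-CriticalPhenomena-4575`), QUANT lane seat prim-quant-census-1 (gen 22), rung R8 of `run/shared/lean/prim/quant/LADDER.md`;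
memo `run/shared/lean/prim/quant/prim-quant-census-1/LSCORE-G22.md` §9–§16 (method: two-low greedy at the breakpoints `kG`, `kB`, `G0`, leaf inequalities by
LP certificates and nested Bernstein forms).  Companion of `…QuantLSCoreMMG` (`lsCore_MMG_decAtT`).  Theorems only, standard axioms, no sorries.
-/
noncomputable section
namespace Summit.CriticalPhenomena.PercolationContinuityZ3.Theorems
namespace Quant
open Finset
namespace LawDec
namespace LSCoreLMG
set_option maxHeartbeats 8000000 in
/-- **`kB` for pattern LMG (low 2 stops at the head cell `p+h` after `m+l′`, pre-routing fits)**: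
`P₁ ≤ (a₂(m+l′) + a₂(p+h)′ − P₂)·κ + pool′`. [this work] -/
theorem kB_LMG (x r t d w e2P e22 e3 κP cPres poolres : ℝ) (hx0 : 0 < x) (hx1 : x < 1) (hr0 : 0 ≤ r) (hrx : r < x) (ht : 0 < t) (hw0 : 0 < w) (hw1 : w ≤ 1)
    (hd0 : 0 ≤ d) (hdx : d < x * w) (hre : 0 < r - x + t * (2 - x)) (hre1 : 0 < 1 - t - r)
    (hM1 : 2 * w < r + d + 2 * t) (hM2 : r + d ≤ 2 * w)
    (h2P_N : 1 ≤ (r + d) → e2P = 0)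
    (h2P_H : x ≤ (r + d) → (r + d) < 1 → e2P = (1 / (r + d) - 1))
    (h2P_L : (r + d) < x → e2P = (1 / ((1 - x) * (r + d) + x ^ (2:ℕ)) - 1))
    (h22_N : w ≤ (r + d) → e22 = 0)
    (h22_H : x * w ≤ (r + d) → (r + d) < w → e22 = (w / (r + d) - 1))
    (h22_L : (r + d) < x * w → e22 = (w / ((1 - x) * (r + d) + x ^ (2:ℕ) * w) - 1))
    (h3_H : x * (1 + t - w) ≤ (r + d + 2 * t - 2 * w) → e3 = (((1 + t - w) - (r + d + 2 * t - 2 * w)) / (r + d + 2 * t - 2 * w)))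
    (h3_L : (r + d + 2 * t - 2 * w) < x * (1 + t - w) → e3 = (((1 + t - w) - ((1 - x) * (r + d + 2 * t - 2 * w) + x ^ (2:ℕ) * (1 + t - w))) / ((1 - x) * (r + d + 2 * t - 2 * w) + x ^ (2:ℕ) * (1 + t - w))))
    (hκ_N : 1 + t ≤ (r + d + 2 * t) → κP = 0) (hκ_H : (r + d + 2 * t) < 1 + t → x ≤ (r + d) → (r + d) < 1 → κP = (((1 + t) - (r + d + 2 * t)) * (r + d) / ((r + d + 2 * t) * (1 - (r + d))))) (hκ_L : (r + d + 2 * t) < 1 + t → (r + d) < x → κP = (((1 + t) - (r + d + 2 * t)) * ((1 - x) * (r + d) + x ^ (2:ℕ)) / ((r + d + 2 * t) * (1 - ((1 - x) * (r + d) + x ^ (2:ℕ))))))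
    (hkA : ((x ^ (2:ℕ) + (1 - x) * d / w) * (1 - x) * ((1 + x - r) * (r - x + t * (2 - x)) / (t * (2 - x ^ (2:ℕ) - (1 - x) * r) - x * (x - r)))) * e22 ≤ ((1 - (x ^ (2:ℕ) + (1 - x) * d / w)) * (1 - x) * ((1 + x - r) * (r - x + t * (2 - x)) / (t * (2 - x ^ (2:ℕ) - (1 - x) * r) - x * (x - r)))))
    (hcase_f : ((x ^ (2:ℕ) + (1 - x) * d / w) * (1 - x) * ((x - r) * (1 - t - r) / (t * (2 - x ^ (2:ℕ) - (1 - x) * r) - x * (x - r)))) ≤ ((1 - (x ^ (2:ℕ) + (1 - x) * d / w)) * x) * e3 → cPres = ((1 - (x ^ (2:ℕ) + (1 - x) * d / w)) * x) - ((x ^ (2:ℕ) + (1 - x) * d / w) * (1 - x) * ((x - r) * (1 - t - r) / (t * (2 - x ^ (2:ℕ) - (1 - x) * r) - x * (x - r)))) / e3 ∧ poolres = ((x ^ (2:ℕ) + (1 - x) * d / w) * (1 - x)))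
    (hcase_s : ((1 - (x ^ (2:ℕ) + (1 - x) * d / w)) * x) * e3 < ((x ^ (2:ℕ) + (1 - x) * d / w) * (1 - x) * ((x - r) * (1 - t - r) / (t * (2 - x ^ (2:ℕ) - (1 - x) * r) - x * (x - r)))) → cPres = 0 ∧ poolres = (((x ^ (2:ℕ) + (1 - x) * d / w) * (1 - x)) - ((x ^ (2:ℕ) + (1 - x) * d / w) * (1 - x) * ((x - r) * (1 - t - r) / (t * (2 - x ^ (2:ℕ) - (1 - x) * r) - x * (x - r)))) + ((1 - (x ^ (2:ℕ) + (1 - x) * d / w)) * x) * e3))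
    (hav : (r + d) < 1) (hf : ((x ^ (2:ℕ) + (1 - x) * d / w) * (1 - x) * ((x - r) * (1 - t - r) / (t * (2 - x ^ (2:ℕ) - (1 - x) * r) - x * (x - r)))) ≤ ((1 - (x ^ (2:ℕ) + (1 - x) * d / w)) * x) * e3) (hpre : ((1 - (x ^ (2:ℕ) + (1 - x) * d / w)) * (1 - x) * ((1 + x - r) * (r - x + t * (2 - x)) / (t * (2 - x ^ (2:ℕ) - (1 - x) * r) - x * (x - r)))) ≤ ((x ^ (2:ℕ) + (1 - x) * d / w) * (1 - x) * ((1 + x - r) * (r - x + t * (2 - x)) / (t * (2 - x ^ (2:ℕ) - (1 - x) * r) - x * (x - r)))) * e22 + cPres * e2P) :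
    ((1 - (x ^ (2:ℕ) + (1 - x) * d / w)) * (1 - x) * ((x - r) * (1 - t - r) / (t * (2 - x ^ (2:ℕ) - (1 - x) * r) - x * (x - r)))) ≤ (((x ^ (2:ℕ) + (1 - x) * d / w) * (1 - x) * ((1 + x - r) * (r - x + t * (2 - x)) / (t * (2 - x ^ (2:ℕ) - (1 - x) * r) - x * (x - r)))) * e22 + cPres * e2P - ((1 - (x ^ (2:ℕ) + (1 - x) * d / w)) * (1 - x) * ((1 + x - r) * (r - x + t * (2 - x)) / (t * (2 - x ^ (2:ℕ) - (1 - x) * r) - x * (x - r))))) * κP + poolres := by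
  rcases le_or_gt (x * (1 + t - w)) ((r + d + 2 * t - 2 * w)) with hk3 | hk3
  · exact kB_LMG_H x r t d w e2P e22 e3 κP cPres poolres hx0 hx1 hr0 hrx ht hw0 hw1 hd0 hdx hre hre1 hM1 hM2 h2P_N h2P_H h2P_L h22_N h22_H h22_L h3_H h3_L hκ_N hκ_H hκ_L hkA hcase_f hcase_s hav hf hpre hk3
  · exact kB_LMG_L x r t d w e2P e22 e3 κP cPres poolres hx0 hx1 hr0 hrx ht hw0 hw1 hd0 hdx hre hre1 hM1 hM2 h2P_N h2P_H h2P_L h22_N h22_H h22_L h3_H h3_L hκ_N hκ_H hκ_L hkA hcase_f hcase_s hav hf hpre hk3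
end LSCoreLMG
open LSCoreMMG LSCoreLMG
set_option maxHeartbeats 40000000 in
/-- **LS-CORE, PATTERN LMG (Type I ⊗ Type I, span ratio ≤ 1).**  As `lsCore_MMG_decAtT` but in the pattern `2(m+l) < T ≤ 2(m+l′)`
(the cell `m+l` is a low, `m+l′` and `p+h` are the mids): the six-cell law `(1−γ)·shift_p ν_B + γ·shift_m ν_B` is `DECAtT x T j M`.
[this work] -/
theorem lsCore_LMG_decAtT (x T ρc ρl ρe lam : ℝ) (p m l l' h j M : ℕ)
    (hx0 : 0 < x) (hx1 : x < 1) (hpm : p < m) (hll : l < l') (hlh : l' < h)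
    (hω : m + l' ≤ p + h) (hPj : p + h ≤ j) (hGj : j < m + h) (hGM : m + h ≤ M)
    (hρc0 : 0 < ρc) (hρcx : ρc < x) (hρl0 : 0 ≤ ρl) (hρlx : ρl < x) (hρex : x < ρe) (hρe1 : ρe < 1)
    (hTB : ρe * ((h : ℝ) - l) = ρl * ((h : ℝ) - l') + 2 * ((l' : ℝ) - l))
    (hT : T = 2 * ((p : ℝ) + l') + ρl * ((h : ℝ) - l') + ρc * ((m : ℝ) - p))
    (hlam0 : 0 ≤ lam) (_hlam1 : lam ≤ 1)
    (hcredit : lam * (ρe - (x ^ (2:ℕ) + (1 - x) * ρl)) = (x - ρl) * (1 - ρe))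
    (hA2 : T ≤ 2 * ((p : ℝ) + h)) (hM1 : 2 * ((m : ℝ) + l) < T) (hM2 : T ≤ 2 * ((m : ℝ) + l')) :
    DECAtT x T j M (fun q => (1 - (x ^ (2:ℕ) + (1 - x) * ρc)) * (1 - x) * lam * (if q = p + l then (1:ℝ) else 0)
      + (1 - (x ^ (2:ℕ) + (1 - x) * ρc)) * (1 - x) * (1 - lam) * (if q = p + l' then (1:ℝ) else 0)
      + (1 - (x ^ (2:ℕ) + (1 - x) * ρc)) * x * (if q = p + h then (1:ℝ) else 0)
      + (x ^ (2:ℕ) + (1 - x) * ρc) * (1 - x) * lam * (if q = m + l then (1:ℝ) else 0)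
      + (x ^ (2:ℕ) + (1 - x) * ρc) * (1 - x) * (1 - lam) * (if q = m + l' then (1:ℝ) else 0)
      + (x ^ (2:ℕ) + (1 - x) * ρc) * x * (if q = m + h then (1:ℝ) else 0)) := by
  classical
  -- ### scale-free coordinates
  have he : (0 : ℝ) < (h : ℝ) - l' := by
    have : (l' : ℝ) < h := by exact_mod_cast hlh
    linarith
  obtain ⟨e, he_def⟩ : ∃ e : ℝ, e = (h : ℝ) - l' := ⟨_, rfl⟩
  rw [← he_def] at he
  set r : ℝ := ρl with hr_def
  obtain ⟨t, ht_def⟩ : ∃ t : ℝ, t = ((l' : ℝ) - l) / e := ⟨_, rfl⟩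
  obtain ⟨w, hw_def⟩ : ∃ w : ℝ, w = ((m : ℝ) - p) / e := ⟨_, rfl⟩
  obtain ⟨d, hd_def⟩ : ∃ d : ℝ, d = ρc * w := ⟨_, rfl⟩
  have hte : t * e = (l' : ℝ) - l := by rw [ht_def]; exact div_mul_cancel₀ _ he.ne'
  have hwe : w * e = (m : ℝ) - p := by rw [hw_def]; exact div_mul_cancel₀ _ he.ne'
  have ht0 : 0 < t := by
    rw [ht_def]; apply div_pos _ he
    have : (l : ℝ) < l' := by exact_mod_cast hll
    linarith
  have hw0 : 0 < w := by
    rw [hw_def]; apply div_pos _ he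
    have : (p : ℝ) < m := by exact_mod_cast hpm
    linarith
  have hw1 : w ≤ 1 := by
    rw [hw_def, div_le_one he]
    have : ((m : ℝ) + l') ≤ (p : ℝ) + h := by exact_mod_cast hω
    linarith
  have hd0 : 0 ≤ d := by rw [hd_def]; positivity
  have hdx : d < x * w := by rw [hd_def]; exact mul_lt_mul_of_pos_right hρcx hw0
  have hρet : ρe * (1 + t) = r + 2 * t := by
    have h1 : ρe * ((h : ℝ) - l) = r * e + 2 * (t * e) := by rw [hTB, hte, he_def]
    have h2 : (h : ℝ) - l = e * (1 + t) := by
      have : (h : ℝ) - l = e + ((l' : ℝ) - l) := by rw [he_def]; ring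
      rw [this, ← hte]; ring
    rw [h2] at h1
    have h3 : e * (ρe * (1 + t)) = e * (r + 2 * t) := by linear_combination h1
    exact mul_left_cancel₀ he.ne' h3
  have ht1 : (0 : ℝ) < 1 + t := by linarith
  have hre : 0 < r - x + t * (2 - x) := by have := mul_lt_mul_of_pos_right hρex ht1; linarith
  have hre1 : 0 < 1 - t - r := by have := mul_lt_mul_of_pos_right hρe1 ht1; linarith
  have hTA : T - 2 * ((p : ℝ) + l') = e * (r + d) := by
    rw [hT, hd_def, hr_def]; rw [show ρc * ((m : ℝ) - p) = ρc * (w * e) by rw [hwe], he_def]; ring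
  have hTB' : T - 2 * ((p : ℝ) + l) = e * (r + d + 2 * t) := by
    have : T - 2 * ((p : ℝ) + l) = (T - 2 * ((p : ℝ) + l')) + 2 * ((l' : ℝ) - l) := by ring
    rw [this, hTA, ← hte]; ring
  have hT3 : T - 2 * ((m : ℝ) + l) = e * (r + d + 2 * t - 2 * w) := by
    have : T - 2 * ((m : ℝ) + l) = (T - 2 * ((p : ℝ) + l)) - 2 * ((m : ℝ) - p) := by ring
    rw [this, hTB', ← hwe]; ring
  have hM1' : 2 * w < r + d + 2 * t := by
    have h1 : 0 < e * (r + d + 2 * t - 2 * w) := by rw [← hT3]; linarith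
    have h2 : e * 0 < e * (r + d + 2 * t - 2 * w) := by rwa [mul_zero]
    have h3 := lt_of_mul_lt_mul_left h2 he.le
    linarith
  have hM2' : r + d ≤ 2 * w := by
    have h1 : e * (r + d) ≤ 2 * ((m : ℝ) + l') - 2 * ((p : ℝ) + l') := by rw [← hTA]; linarith
    have h2 : 2 * ((m : ℝ) + l') - 2 * ((p : ℝ) + l') = e * (2 * w) := by rw [show e * (2 * w) = 2 * (w * e) by ring, hwe]; ring
    rw [h2] at h1
    exact le_of_mul_le_mul_left h1 he
  have hA2' : r + d ≤ 2 := by linarith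
  have hApos : 0 < r + d := by
    have : 0 < d := by rw [hd_def]; positivity
    linarith
  have hB3pos : 0 < r + d + 2 * t - 2 * w := by linarith
  have hb3c : r + d + 2 * t - 2 * w < 1 + t - w := by nlinarith
  -- ### the tail weights in closed form
  have hD : 0 < t * (2 - x ^ (2:ℕ) - (1 - x) * r) - x * (x - r) := LSCoreMMG.D_pos x r t hx0 hx1 hρl0 hρlx hre
  have hlamD : lam * (t * (2 - x ^ (2:ℕ) - (1 - x) * r) - x * (x - r)) = (x - r) * (1 - t - r) := by
    linear_combination (1 + t) * hcredit - (lam + (x - r)) * hρet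
  have hlam_eq : (x - r) * (1 - t - r) / (t * (2 - x ^ (2:ℕ) - (1 - x) * r) - x * (x - r)) = lam := by
    rw [div_eq_iff hD.ne', hlamD]
  have hlaml_eq : (1 + x - r) * (r - x + t * (2 - x)) / (t * (2 - x ^ (2:ℕ) - (1 - x) * r) - x * (x - r)) = 1 - lam := by rw [div_eq_iff hD.ne']; linear_combination hlamD
  have hgd : x ^ (2:ℕ) + (1 - x) * d / w = x ^ (2:ℕ) + (1 - x) * ρc := by
    rw [hd_def, mul_div_assoc, mul_div_cancel_right₀ _ hw0.ne']
  -- ### masses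
  have hγ0 : 0 < (x ^ (2:ℕ) + (1 - x) * ρc) := by positivity
  have hγ1 : (x ^ (2:ℕ) + (1 - x) * ρc) < 1 := by have := mul_lt_mul_of_pos_left hρcx (sub_pos.2 hx1); nlinarith
  have hγ1' : 0 ≤ 1 - (x ^ (2:ℕ) + (1 - x) * ρc) := by linarith
  have hc1 : 0 ≤ (1 - (x ^ (2:ℕ) + (1 - x) * ρc)) * (1 - x) * lam := mul_nonneg (mul_nonneg hγ1' (by linarith)) hlam0
  have hc2 : 0 ≤ (1 - (x ^ (2:ℕ) + (1 - x) * ρc)) * (1 - x) * (1 - lam) := mul_nonneg (mul_nonneg hγ1' (by linarith)) (by linarith)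
  have hcP : 0 ≤ (1 - (x ^ (2:ℕ) + (1 - x) * ρc)) * x := mul_nonneg hγ1' hx0.le
  have hd1 : 0 ≤ (x ^ (2:ℕ) + (1 - x) * ρc) * (1 - x) * lam := mul_nonneg (mul_nonneg hγ0.le (by linarith)) hlam0
  have hd2 : 0 ≤ (x ^ (2:ℕ) + (1 - x) * ρc) * (1 - x) * (1 - lam) := mul_nonneg (mul_nonneg hγ0.le (by linarith)) (by linarith)
  have hdG : 0 ≤ (x ^ (2:ℕ) + (1 - x) * ρc) * x := mul_nonneg hγ0.le hx0.le
  have hu : 0 < x / (1 - x) := div_pos hx0 (by linarith)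
  -- ### efficiencies and exchange ratios (the MMG package) and the pre-routing efficiency `e3`
  obtain ⟨e2P, e22, e21, e1P, e12, e11, κC, κB, κA, h2P_N, h2P_H, h2P_L, h22_N, h22_H, h22_L, h21_N, h21_H, h21_L, h1P_N, h1P_H, h12_N, h12_H, h11_N, h11_H, he2P0, he220, he210, he1P0, he120, he110, hκC_N, hκC_H, hκC_L, hκB_N, hκB_H, hκB_L, hκA_N, hκA_H, hκA_L, hκC0, hκB0, hκA0, hκCe, hκBe, hκAe⟩ :=
    eff_package x r t d w hx0 hx1 ht0 hw0 hApos
  obtain ⟨e3, h3_H, h3_L⟩ : ∃ e3 : ℝ, (x * (1 + t - w) ≤ (r + d + 2 * t - 2 * w) → e3 = (((1 + t - w) - (r + d + 2 * t - 2 * w)) / (r + d + 2 * t - 2 * w))) ∧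
      ((r + d + 2 * t - 2 * w) < x * (1 + t - w) → e3 = (((1 + t - w) - ((1 - x) * (r + d + 2 * t - 2 * w) + x ^ (2:ℕ) * (1 + t - w))) / ((1 - x) * (r + d + 2 * t - 2 * w) + x ^ (2:ℕ) * (1 + t - w)))) := by
    by_cases hh : x * (1 + t - w) ≤ (r + d + 2 * t - 2 * w)
    · exact ⟨(((1 + t - w) - (r + d + 2 * t - 2 * w)) / (r + d + 2 * t - 2 * w)), fun _ => rfl, fun h2 => absurd hh (not_le.2 h2)⟩
    · exact ⟨(((1 + t - w) - ((1 - x) * (r + d + 2 * t - 2 * w) + x ^ (2:ℕ) * (1 + t - w))) / ((1 - x) * (r + d + 2 * t - 2 * w) + x ^ (2:ℕ) * (1 + t - w))), fun h2 => absurd h2 hh, fun _ => rfl⟩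
  -- ### usage of the cross pairs in scaled coordinates
  have hBpos : 0 < r + d + 2 * t := by linarith
  have hxB : x * (1 + t) ≤ r + d + 2 * t := by have := mul_lt_mul_of_pos_right hρex ht1; linarith
  have hΔC2 : T - 2 * ((p + l' : ℕ) : ℝ) = e * (r + d) := by push_cast; linarith [hTA]
  have hΔC1 : T - 2 * ((p + l : ℕ) : ℝ) = e * (r + d + 2 * t) := by push_cast; linarith [hTB']
  have hΔ3 : T - 2 * ((m + l : ℕ) : ℝ) = e * (r + d + 2 * t - 2 * w) := by push_cast; linarith [hT3]
  have hδC2 : ((p + h : ℕ) : ℝ) - ((p + l' : ℕ) : ℝ) = e * 1 := by push_cast; linear_combination -he_def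
  have hδC1 : ((p + h : ℕ) : ℝ) - ((p + l : ℕ) : ℝ) = e * (1 + t) := by push_cast; linear_combination -he_def - hte
  have hδB2 : ((m + l' : ℕ) : ℝ) - ((p + l' : ℕ) : ℝ) = e * w := by push_cast; linear_combination -hwe
  have hδB1 : ((m + l' : ℕ) : ℝ) - ((p + l : ℕ) : ℝ) = e * (w + t) := by push_cast; linear_combination -hwe - hte
  have hδ3 : ((p + h : ℕ) : ℝ) - ((m + l : ℕ) : ℝ) = e * (1 + t - w) := by push_cast; linear_combination -he_def - hte + hwe
  have hm2j : m + l' ≤ j := le_trans hω hPj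
  have havC2 : (T < ((p + l' : ℕ) : ℝ) + ((p + h : ℕ) : ℝ)) ↔ r + d < 1 := by
    constructor
    · intro hh
      have h1 : e * (r + d) < e * (1) := by linarith [hΔC2, hδC2]
      exact lt_of_mul_lt_mul_left h1 he.le
    · intro hh
      have h1 : e * (r + d) < e * (1) := mul_lt_mul_of_pos_left hh he
      linarith [hΔC2, hδC2]
  have havC1 : (T < ((p + l : ℕ) : ℝ) + ((p + h : ℕ) : ℝ)) ↔ r + d + 2 * t < 1 + t := by
    constructor
    · intro hh
      have h1 : e * (r + d + 2 * t) < e * (1 + t) := by linarith [hΔC1, hδC1]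
      exact lt_of_mul_lt_mul_left h1 he.le
    · intro hh
      have h1 : e * (r + d + 2 * t) < e * (1 + t) := mul_lt_mul_of_pos_left hh he
      linarith [hΔC1, hδC1]
  have havB2 : (T < ((p + l' : ℕ) : ℝ) + ((m + l' : ℕ) : ℝ)) ↔ r + d < w := by
    constructor
    · intro hh
      have h1 : e * (r + d) < e * (w) := by linarith [hΔC2, hδB2]
      exact lt_of_mul_lt_mul_left h1 he.le
    · intro hh
      have h1 : e * (r + d) < e * (w) := mul_lt_mul_of_pos_left hh he
      linarith [hΔC2, hδB2]
  have havB1 : (T < ((p + l : ℕ) : ℝ) + ((m + l' : ℕ) : ℝ)) ↔ r + d + 2 * t < w + t := by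
    constructor
    · intro hh
      have h1 : e * (r + d + 2 * t) < e * (w + t) := by linarith [hΔC1, hδB1]
      exact lt_of_mul_lt_mul_left h1 he.le
    · intro hh
      have h1 : e * (r + d + 2 * t) < e * (w + t) := mul_lt_mul_of_pos_left hh he
      linarith [hΔC1, hδB1]
  have hav3 : T < ((m + l : ℕ) : ℝ) + ((p + h : ℕ) : ℝ) := by have h1 : e * (r + d + 2 * t - 2 * w) < e * (1 + t - w) := mul_lt_mul_of_pos_left hb3c he; linarith [hΔ3, hδ3]
  have huC2 : r + d < 1 → 0 < usage x T j (p + l') (p + h) ∧ e2P * usage x T j (p + l') (p + h) = 1 := by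
    intro hav
    rcases lt_or_ge (r + d) x with hL | hH
    · rw [h2P_L hL]
      have := usage_light_scaled x T e (r + d) 1 j (p + l') (p + h) hx0 hx1 he hPj hΔC2 hδC2 hApos hav (by linarith)
      simpa only [mul_one] using this
    · rw [h2P_H hH hav]
      exact usage_heavy_scaled x T e (r + d) 1 j (p + l') (p + h) hx0 hx1 he hPj hΔC2 hδC2 hApos hav (by linarith)
  have huC1 : r + d + 2 * t < 1 + t → 0 < usage x T j (p + l) (p + h) ∧ e1P * usage x T j (p + l) (p + h) = 1 := by
    intro hav
    rw [h1P_H hav]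
    exact usage_heavy_scaled x T e (r + d + 2 * t) (1 + t) j (p + l) (p + h) hx0 hx1 he hPj hΔC1 hδC1 hBpos hav hxB
  have huB2 : r + d < w → 0 < usage x T j (p + l') (m + l') ∧ e22 * usage x T j (p + l') (m + l') = 1 := by
    intro hav
    rcases lt_or_ge (r + d) (x * w) with hL | hH
    · rw [h22_L hL]
      exact usage_light_scaled x T e (r + d) w j (p + l') (m + l') hx0 hx1 he hm2j hΔC2 hδB2 hApos hav hL.le
    · rw [h22_H hH hav]
      exact usage_heavy_scaled x T e (r + d) w j (p + l') (m + l') hx0 hx1 he hm2j hΔC2 hδB2 hApos hav hH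
  have huB1 : r + d + 2 * t < w + t → 0 < usage x T j (p + l) (m + l') ∧ e12 * usage x T j (p + l) (m + l') = 1 := by
    intro hav
    rw [h12_H hav]
    exact usage_heavy_scaled x T e (r + d + 2 * t) (w + t) j (p + l) (m + l') hx0 hx1 he hm2j hΔC1 hδB1 hBpos hav
      (by have := mul_le_mul_of_nonneg_left (show w + t ≤ 1 + t by linarith) hx0.le; linarith)
  have hG3pos : 0 < (1 - x) * (r + d + 2 * t - 2 * w) + x ^ (2:ℕ) * (1 + t - w) := add_pos_of_pos_of_nonneg (mul_pos (by linarith) hB3pos) (mul_nonneg (sq_nonneg x) (by linarith))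
  have hu3 : 0 < usage x T j (m + l) (p + h) ∧ e3 * usage x T j (m + l) (p + h) = 1 := by
    rcases le_or_gt (x * (1 + t - w)) (r + d + 2 * t - 2 * w) with hH | hL
    · rw [h3_H hH]
      have := usage_heavy_scaled x T e (r + d + 2 * t - 2 * w) (1 + t - w) j (m + l) (p + h) hx0 hx1 he hPj hΔ3 hδ3 hB3pos hb3c hH
      rwa [div_sub_one hB3pos.ne'] at this
    · rw [h3_L hL]
      have := usage_light_scaled x T e (r + d + 2 * t - 2 * w) (1 + t - w) j (m + l) (p + h) hx0 hx1 he hPj hΔ3 hδ3 hB3pos hb3c hL.le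
      rwa [div_sub_one hG3pos.ne'] at this
  obtain ⟨hU3pos, he3U⟩ := hu3
  have he3pos : 0 < e3 := by by_contra hn; have : e3 * usage x T j (m + l) (p + h) ≤ 0 := mul_nonpos_iff.2 (Or.inr ⟨not_lt.1 hn, hU3pos.le⟩); linarith
  have he3inv : 1 / e3 = usage x T j (m + l) (p + h) := by rw [div_eq_iff he3pos.ne', mul_comm]; exact he3U.symm
  -- ### pre-routing of the low `m+l` into the head cell
  set f₃ : ℝ := if (x ^ (2:ℕ) + (1 - x) * ρc) * (1 - x) * lam ≤ (1 - (x ^ (2:ℕ) + (1 - x) * ρc)) * x * e3 then (x ^ (2:ℕ) + (1 - x) * ρc) * (1 - x) * lam else (1 - (x ^ (2:ℕ) + (1 - x) * ρc)) * x * e3 with hf₃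
  have hf30 : 0 ≤ f₃ := by rw [hf₃]; split_ifs <;> positivity
  have hf3le : f₃ ≤ (x ^ (2:ℕ) + (1 - x) * ρc) * (1 - x) * lam := by
    rw [hf₃]; split_ifs with hh
    · exact le_rfl
    · exact (not_le.1 hh).le
  have hf3cap : usage x T j (m + l) (p + h) * f₃ ≤ (1 - (x ^ (2:ℕ) + (1 - x) * ρc)) * x := by
    rw [hf₃]; split_ifs with hh
    · calc usage x T j (m + l) (p + h) * ((x ^ (2:ℕ) + (1 - x) * ρc) * (1 - x) * lam) ≤ usage x T j (m + l) (p + h) * ((1 - (x ^ (2:ℕ) + (1 - x) * ρc)) * x * e3) := mul_le_mul_of_nonneg_left hh hU3pos.le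
        _ = (1 - (x ^ (2:ℕ) + (1 - x) * ρc)) * x * (e3 * usage x T j (m + l) (p + h)) := by ring
        _ = (1 - (x ^ (2:ℕ) + (1 - x) * ρc)) * x := by rw [he3U, mul_one]
    · calc usage x T j (m + l) (p + h) * ((1 - (x ^ (2:ℕ) + (1 - x) * ρc)) * x * e3) = (1 - (x ^ (2:ℕ) + (1 - x) * ρc)) * x * (e3 * usage x T j (m + l) (p + h)) := by ring
        _ = (1 - (x ^ (2:ℕ) + (1 - x) * ρc)) * x := by rw [he3U, mul_one]
      exact le_rfl
  set cPres : ℝ := (1 - (x ^ (2:ℕ) + (1 - x) * ρc)) * x - usage x T j (m + l) (p + h) * f₃ with hcPres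
  set poolG : ℝ := (x ^ (2:ℕ) + (1 - x) * ρc) * x - x / (1 - x) * ((x ^ (2:ℕ) + (1 - x) * ρc) * (1 - x) * lam - f₃) with hpoolG
  have hcPres0 : 0 ≤ cPres := by rw [hcPres]; linarith
  have hcGu : (x ^ (2:ℕ) + (1 - x) * ρc) * x / (x / (1 - x)) = (x ^ (2:ℕ) + (1 - x) * ρc) * (1 - x) := by field_simp
  have hx1' : (1 : ℝ) - x ≠ 0 := by linarith
  have hx0' : x ≠ 0 := hx0.ne'
  have hpoolGu : poolG / (x / (1 - x)) = (x ^ (2:ℕ) + (1 - x) * ρc) * (1 - x) - ((x ^ (2:ℕ) + (1 - x) * ρc) * (1 - x) * lam - f₃) := by rw [div_eq_iff hu.ne', hpoolG]; field_simp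
  -- the two cases of the pre-routing, in the closed forms of the breakpoint lemmas
  have hcase_f : ((x ^ (2:ℕ) + (1 - x) * d / w) * (1 - x) * ((x - r) * (1 - t - r) / (t * (2 - x ^ (2:ℕ) - (1 - x) * r) - x * (x - r)))) ≤ ((1 - (x ^ (2:ℕ) + (1 - x) * d / w)) * x) * e3 → cPres = ((1 - (x ^ (2:ℕ) + (1 - x) * d / w)) * x) - ((x ^ (2:ℕ) + (1 - x) * d / w) * (1 - x) * ((x - r) * (1 - t - r) / (t * (2 - x ^ (2:ℕ) - (1 - x) * r) - x * (x - r)))) / e3 ∧ poolG / (x / (1 - x)) = ((x ^ (2:ℕ) + (1 - x) * d / w) * (1 - x)) := by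
    rw [hgd, hlam_eq]
    intro hle
    have hf : f₃ = (x ^ (2:ℕ) + (1 - x) * ρc) * (1 - x) * lam := by rw [hf₃, if_pos hle]
    refine ⟨?_, ?_⟩
    · rw [hcPres, hf, div_eq_mul_one_div, he3inv]; ring
    · rw [hpoolGu, hf]; ring
  have hcase_s : ((1 - (x ^ (2:ℕ) + (1 - x) * d / w)) * x) * e3 < ((x ^ (2:ℕ) + (1 - x) * d / w) * (1 - x) * ((x - r) * (1 - t - r) / (t * (2 - x ^ (2:ℕ) - (1 - x) * r) - x * (x - r)))) → cPres = 0 ∧ poolG / (x / (1 - x)) = (((x ^ (2:ℕ) + (1 - x) * d / w) * (1 - x)) - ((x ^ (2:ℕ) + (1 - x) * d / w) * (1 - x) * ((x - r) * (1 - t - r) / (t * (2 - x ^ (2:ℕ) - (1 - x) * r) - x * (x - r)))) + ((1 - (x ^ (2:ℕ) + (1 - x) * d / w)) * x) * e3) := by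
    rw [hgd, hlam_eq]
    intro hlt
    have hf : f₃ = (1 - (x ^ (2:ℕ) + (1 - x) * ρc)) * x * e3 := by rw [hf₃, if_neg (not_le.2 hlt)]
    refine ⟨?_, ?_⟩
    · rw [hcPres, hf]
      calc (1 - (x ^ (2:ℕ) + (1 - x) * ρc)) * x - usage x T j (m + l) (p + h) * ((1 - (x ^ (2:ℕ) + (1 - x) * ρc)) * x * e3) = (1 - (x ^ (2:ℕ) + (1 - x) * ρc)) * x * (1 - e3 * usage x T j (m + l) (p + h)) := by ring
        _ = 0 := by rw [he3U]; ring
    · rw [hpoolGu, hf]; ring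
  -- ### the breakpoint inequalities (scale-free closed forms), rewritten in terms of `lam`, `(x ^ (2:ℕ) + (1 - x) * ρc)`
  have hkG' := kG_LMG x r t d w e2P e22 e3 cPres (poolG / (x / (1 - x))) hx0 hx1 hρl0 hρlx ht0 hw0 hw1 hd0 hdx hre hre1 hM1' hM2'
    h2P_N h2P_H h2P_L h22_N h22_H h22_L h3_H h3_L hcase_f hcase_s
  have hkA' := kAfact_LMG x r t d w e22 hx0 hx1 hρl0 hρlx ht0 hw0 hw1 hd0 hdx hre hre1 hM1' hM2' h22_N h22_H h22_L
  have hkB' := kB_LMG x r t d w e2P e22 e3 κC cPres (poolG / (x / (1 - x))) hx0 hx1 hρl0 hρlx ht0 hw0 hw1 hd0 hdx hre hre1 hM1' hM2'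
    h2P_N h2P_H h2P_L h22_N h22_H h22_L h3_H h3_L hκC_N hκC_H hκC_L hkA' hcase_f hcase_s
  have hG0' := G0_LMG x r t d w e3 cPres (poolG / (x / (1 - x))) hx0 hx1 hρl0 hρlx ht0 hw0 hw1 hd0 hdx hre hre1 hM1' hM2'
    h3_H h3_L hcase_f hcase_s
  have hcase_s' := hcase_s
  rw [hgd, hlam_eq] at hcase_s'
  rw [hgd, hlam_eq, hlaml_eq] at hkG' hkB'
  rw [hgd, hlaml_eq] at hkA'
  have hpoolG0 : 0 ≤ poolG := by have := mul_nonneg hG0' hu.le; rwa [div_mul_cancel₀ _ hu.ne'] at this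
  -- identities between the abstract efficiencies
  have he1P_of_N : 1 ≤ r + d → e1P = 0 := fun h1 => h1P_N (by linarith)
  have hκCe' : cPres * e2P * κC = cPres * e1P := by
    rcases lt_or_ge (r + d + 2 * t) (1 + t) with h1 | h1
    · rw [mul_assoc, mul_comm e2P κC, hκCe h1]
    · rw [hκC_N h1, h1P_N h1]; ring
  -- ### the greedy
  obtain ⟨F₁A, F₁B, F₁C, R₁, F₂A, F₂B, F₂C, R₂, f1A0, f1B0, f1C0, R10, f2A0, f2B0, f2C0, R20,
      av1A, av1B, av1C, av2A, av2B, av2C, row1, row2, capA, capB, capC, capG⟩ :=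
    twoLow_greedy_flows ((1 - (x ^ (2:ℕ) + (1 - x) * ρc)) * (1 - x) * lam) ((1 - (x ^ (2:ℕ) + (1 - x) * ρc)) * (1 - x) * (1 - lam)) (x / (1 - x)) poolG ((x ^ (2:ℕ) + (1 - x) * ρc) * (1 - x) * (1 - lam)) cPres 0
      (usage x T j (p + l) (m + l')) (usage x T j (p + l') (m + l')) (usage x T j (p + l) (p + h)) (usage x T j (p + l') (p + h)) 1 1
      ((x ^ (2:ℕ) + (1 - x) * ρc) * (1 - x) * (1 - lam) * e22) (cPres * e1P) (cPres * e2P) 0 0 κB κC 0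
      (T < ((p + l : ℕ) : ℝ) + ((m + l' : ℕ) : ℝ)) (T < ((p + l' : ℕ) : ℝ) + ((m + l' : ℕ) : ℝ))
      (T < ((p + l : ℕ) : ℝ) + ((p + h : ℕ) : ℝ)) (T < ((p + l' : ℕ) : ℝ) + ((p + h : ℕ) : ℝ)) False False
      hc1 hc2 hu hpoolG0 hd2 hcPres0 le_rfl
      (mul_nonneg hd2 he220) (mul_nonneg hcPres0 he1P0) (mul_nonneg hcPres0 he2P0) le_rfl le_rfl
      (fun hav => by obtain ⟨h1, h2⟩ := huB2 (havB2.1 hav); exact ⟨h1, by rw [mul_assoc, h2, mul_one]⟩)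
      (fun hn => by rw [h22_N (not_lt.1 (fun hh => hn (havB2.2 hh))), mul_zero])
      (fun hav => by obtain ⟨h1, h2⟩ := huC1 (havC1.1 hav); exact ⟨h1, by rw [mul_assoc, h2, mul_one]⟩)
      (fun hn => by rw [h1P_N (not_lt.1 (fun hh => hn (havC1.2 hh))), mul_zero])
      (fun hav => by obtain ⟨h1, h2⟩ := huC2 (havC2.1 hav); exact ⟨h1, by rw [mul_assoc, h2, mul_one]⟩)
      (fun hn => by rw [h2P_N (not_lt.1 (fun hh => hn (havC2.2 hh))), mul_zero])
      (fun hF => hF.elim) (fun _ => rfl) (fun hF => hF.elim) (fun _ => rfl)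
      hκB0
      (fun hav => by
        have h1 := havB1.1 hav
        have h2 : r + d < w := by linarith
        obtain ⟨_, u1⟩ := huB1 h1
        obtain ⟨_, u2⟩ := huB2 h2
        have h3 := hκBe h1
        calc κB * usage x T j (p + l) (m + l')
            = κB * usage x T j (p + l) (m + l') * (e22 * usage x T j (p + l') (m + l')) := by rw [u2, mul_one]
          _ = (κB * e22) * usage x T j (p + l) (m + l') * usage x T j (p + l') (m + l') := by ring
          _ = (e12 * usage x T j (p + l) (m + l')) * usage x T j (p + l') (m + l') := by rw [h3]
          _ = usage x T j (p + l') (m + l') := by rw [u1, one_mul])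
      (fun hn => hκB_N (not_lt.1 (fun hh => hn (havB1.2 hh))))
      hκC0
      (fun hav => by
        have h1 := havC1.1 hav
        have h2 : r + d < 1 := by linarith
        obtain ⟨_, u1⟩ := huC1 h1
        obtain ⟨_, u2⟩ := huC2 h2
        have h3 := hκCe h1
        calc κC * usage x T j (p + l) (p + h)
            = κC * usage x T j (p + l) (p + h) * (e2P * usage x T j (p + l') (p + h)) := by rw [u2, mul_one]
          _ = (κC * e2P) * usage x T j (p + l) (p + h) * usage x T j (p + l') (p + h) := by ring
          _ = (e1P * usage x T j (p + l) (p + h)) * usage x T j (p + l') (p + h) := by rw [h3]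
          _ = usage x T j (p + l') (p + h) := by rw [u1, one_mul])
      (fun hn => hκC_N (not_lt.1 (fun hh => hn (havC1.2 hh))))
      le_rfl (fun hF => hF.elim) (fun _ => rfl)
      (fun hav hP2 => by
        -- `hkA`: low 2 would fit in `m+l′` — only on the boundary `a₂(m+l′) = P₂`
        have heq : (x ^ (2:ℕ) + (1 - x) * ρc) * (1 - x) * (1 - lam) * e22 = (1 - (x ^ (2:ℕ) + (1 - x) * ρc)) * (1 - x) * (1 - lam) := le_antisymm hkA' hP2
        by_cases hfit : (x ^ (2:ℕ) + (1 - x) * ρc) * (1 - x) * lam ≤ (1 - (x ^ (2:ℕ) + (1 - x) * ρc)) * x * e3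
        · rcases lt_or_ge (r + d) 1 with h2 | h2n
          · have hB := hkB' h2 hfit (by rw [heq]; linarith [mul_nonneg hcPres0 he2P0])
            rw [heq, add_sub_cancel_left, hκCe'] at hB
            simp only [heq, sub_self, zero_mul, zero_add, add_zero]
            exact hB
          · have hG := hkG' (by rw [heq, h2P_N h2n, mul_zero, add_zero])
            rw [heq, h2P_N h2n, mul_zero, add_zero] at hG
            simp only [heq, sub_self, zero_mul, zero_add, add_zero, he1P_of_N h2n, mul_zero]
            linarith
        · obtain ⟨hc0, _⟩ := hcase_s' (not_le.1 hfit)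
          have hG := hkG' (by rw [heq, hc0, zero_mul, add_zero])
          rw [heq, hc0, zero_mul, add_zero] at hG
          simp only [heq, sub_self, zero_mul, zero_add, add_zero, hc0]
          linarith)
      (fun hav hlo hhi => by
        by_cases hfit : (x ^ (2:ℕ) + (1 - x) * ρc) * (1 - x) * lam ≤ (1 - (x ^ (2:ℕ) + (1 - x) * ρc)) * x * e3
        · have hB := hkB' (havC2.1 hav) hfit hhi
          simp only [add_zero]
          exact hB
        · obtain ⟨hc0, _⟩ := hcase_s' (not_le.1 hfit)
          rw [hc0, zero_mul, add_zero] at hhi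
          have heq : (x ^ (2:ℕ) + (1 - x) * ρc) * (1 - x) * (1 - lam) * e22 = (1 - (x ^ (2:ℕ) + (1 - x) * ρc)) * (1 - x) * (1 - lam) := le_antisymm hkA' hhi
          have hG := hkG' (by rw [heq, hc0, zero_mul, add_zero])
          rw [heq, hc0, zero_mul, add_zero] at hG
          simp only [heq, hc0, zero_mul, add_zero, sub_self, zero_add]
          linarith)
      (fun hF _ _ => hF.elim)
      (fun hsum => by simp only [add_zero]; exact hkG' (by simpa only [add_zero] using hsum))
  -- ### the flow lemma
  have hsum : (1 - (x ^ (2:ℕ) + (1 - x) * ρc)) * (1 - x) * lam + (1 - (x ^ (2:ℕ) + (1 - x) * ρc)) * (1 - x) * (1 - lam) + (1 - (x ^ (2:ℕ) + (1 - x) * ρc)) * x + (x ^ (2:ℕ) + (1 - x) * ρc) * (1 - x) * lam + (x ^ (2:ℕ) + (1 - x) * ρc) * (1 - x) * (1 - lam) + (x ^ (2:ℕ) + (1 - x) * ρc) * x = 1 := by ring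
  have hlow : 2 * ((p : ℝ) + l') < T := by have := mul_pos he hApos; linarith [hTA]
  have hR1 : F₁B + F₁A ≤ (1 - (x ^ (2:ℕ) + (1 - x) * ρc)) * (1 - x) * lam := by linarith
  have hR2 : F₂B + F₂A ≤ (1 - (x ^ (2:ℕ) + (1 - x) * ρc)) * (1 - x) * (1 - lam) := by linarith
  have hR3 : f₃ + 0 ≤ (x ^ (2:ℕ) + (1 - x) * ρc) * (1 - x) * lam := by linarith
  have hF1C0 : F₁C = 0 := by by_contra hne; exact av1C (lt_of_le_of_ne f1C0 (Ne.symm hne))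
  have hF2C0 : F₂C = 0 := by by_contra hne; exact av2C (lt_of_le_of_ne f2C0 (Ne.symm hne))
  have hcapP' : usage x T j (p + l) (p + h) * F₁B + usage x T j (p + l') (p + h) * F₂B + usage x T j (m + l) (p + h) * f₃ ≤ (1 - (x ^ (2:ℕ) + (1 - x) * ρc)) * x := by
    have : usage x T j (p + l) (p + h) * F₁B + usage x T j (p + l') (p + h) * F₂B ≤ cPres := capB
    rw [hcPres] at this; linarith
  have hcap2' : usage x T j (p + l) (m + l') * F₁A + usage x T j (p + l') (m + l') * F₂A + usage x T j (m + l) (m + l') * 0 ≤ (x ^ (2:ℕ) + (1 - x) * ρc) * (1 - x) * (1 - lam) := by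
    rw [mul_zero, add_zero]; exact capA
  have hcapG' : x / (1 - x) * (((1 - (x ^ (2:ℕ) + (1 - x) * ρc)) * (1 - x) * lam - F₁B - F₁A) + ((1 - (x ^ (2:ℕ) + (1 - x) * ρc)) * (1 - x) * (1 - lam) - F₂B - F₂A) + ((x ^ (2:ℕ) + (1 - x) * ρc) * (1 - x) * lam - f₃ - 0)) ≤ (x ^ (2:ℕ) + (1 - x) * ρc) * x := by
    have e1 : ((1 - (x ^ (2:ℕ) + (1 - x) * ρc)) * (1 - x) * lam - F₁B - F₁A) + ((1 - (x ^ (2:ℕ) + (1 - x) * ρc)) * (1 - x) * (1 - lam) - F₂B - F₂A) = R₁ + R₂ := by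
      rw [hF1C0] at row1; rw [hF2C0] at row2; linarith
    rw [e1]
    have : x / (1 - x) * (R₁ + R₂) ≤ poolG := capG
    rw [hpoolG] at this
    have e2 : x / (1 - x) * (R₁ + R₂ + ((x ^ (2:ℕ) + (1 - x) * ρc) * (1 - x) * lam - f₃ - 0)) = x / (1 - x) * (R₁ + R₂) + x / (1 - x) * ((x ^ (2:ℕ) + (1 - x) * ρc) * (1 - x) * lam - f₃) := by ring
    rw [e2]; linarith
  exact lsLaw_decAtT_of_flow_LMG x T ((1 - (x ^ (2:ℕ) + (1 - x) * ρc)) * (1 - x) * lam) ((1 - (x ^ (2:ℕ) + (1 - x) * ρc)) * (1 - x) * (1 - lam)) ((1 - (x ^ (2:ℕ) + (1 - x) * ρc)) * x) ((x ^ (2:ℕ) + (1 - x) * ρc) * (1 - x) * lam) ((x ^ (2:ℕ) + (1 - x) * ρc) * (1 - x) * (1 - lam)) ((x ^ (2:ℕ) + (1 - x) * ρc) * x) F₁B F₁A F₂B F₂A f₃ 0 p m l l' h j M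
    hx0 hx1 hsum hpm hll hlh hlow hM1 hM2 hA2 hPj hm2j hGj hGM f1B0 f1A0 f2B0 f2A0 hf30 le_rfl
    av1B av1A av2B av2A (fun _ => hav3) (fun h0 => absurd h0 (lt_irrefl 0)) hR1 hR2 hR3 hcapP' hcap2' hcapG'
end LawDec
end Quant
end Summit.CriticalPhenomena.PercolationContinuityZ3.Theorems
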